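import Literature.Analysis.OperatorTheory.TwistedKernelFluxSectors
import Summits.QuantumFields.YangMills.Theorems.BalabanLadderIRcofThickSpeciesDatum
import HarnessLib

/-!
# Equipartition seam, thick species — the PEELING theorem in the FLUX-COEFFICIENT currency (no joint eigenbasis; 0 sorry)

Helper for crux `IRcof` (stmt-QuantumFields-26930), census row 47 «equipartition-seam» (skeleton rev 8, custody ym-ir-idea-22; located
stub D `SpectralDictV`).  Companion of `Theorems/BalabanLadderIRcofThickSpeciesDatum.lean` (p685489: the same theorem in the JOINT-EIGENBASIS
currency `xᵢ ≥ 0`, unit multiplicative flux labels `χᵢ : Zc → ℂ`).  WHY A SECOND CURRENCY: the joint-eigenbasis form presupposes a basis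
diagonalising BOTH the transfer operator AND the finite abelian twist action with COMPLEX characters — over the tree's REAL `L²` slice spaces
this needs complexification (for `|Γ| ≥ 3` the twist sectors are genuinely complex), and no such joint-eigenbasis theorem is in the tree.
The tree's 't Hooft flux machinery (`Literature.Analysis.OperatorTheory.TwistedKernelFluxSectors`) delivers instead, from ONE eigenbasis of
the transfer operator alone, the FLUX PROJECTIONS `F̂(ψ) := |Γ|⁻¹ Σ_k conj ψ(k) F(k)` of every twisted-trace family `F : Γ → ℂ`
(`Γ` additive finite abelian, `ψ : AddChar Γ ℂ`), their POSITIVITY (`fluxSector_nonneg`), completeness and Fourier inversion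
(`sum_fluxProjection_eq`, `sum_apply_mul_fluxProjection_eq`).  In that currency the peeling theorem needs NO eigen-data at all — only:

* SECTOR-WISE insertion domination `‖Ŵ(ψ)‖ ≤ β · Re X̂(ψ)` (read: `|tr(P_ψ 𝕋^s 𝔹)| ≤ ‖𝔹‖·tr(P_ψ 𝕋^s)`, the trace–operator-norm
  Hölder bound for the PSD sector operator `P_ψ 𝕋^s` — exactly the `hdom` shape of idea-22's `FluxFourier`, and what kernel domination gives);
* equipartition of `X` (`‖X k − X 0‖ ≤ δ·Re X 0`) and of the second block's traces `Z` (`‖Z k − Z₀‖ ≤ δ Z₀`), the slack `β·Re X 0 ≤ K·Z₀`.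

* `fluxMass_le_of_equipartition` — `Re X 0 − Re X̂(0) = |Γ|⁻¹ Σ_k Re (X 0 − X k) ≤ δ·Re X 0`: the non-trivial-flux MASS `Σ_{ψ≠0} Re X̂(ψ)` is small
  (group average; no dual-group count).
* `insertion_fluxUniform_flux` — `‖W k − W 0‖ ≤ 2·β·δ·Re X 0` and `norm_insertion_le_flux` — `‖W 0‖ ≤ β·Re X 0`.
* ★ `eblind_thick_flux` — `‖W a·Z b − W b·Z a‖ ≤ 10·K·δ·Z₀²` (rate preserved; constant as in the eigen-data form), via the landed
  `ThickSpeciesDatum.pairBound_of_uniform`.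

So the typer of D may EITHER produce the joint eigen-datum (and use p685489) OR stay in the tree's flux-sector currency (and use this file);
the located content of D is the same either way (sector-wise domination of the dressed insertion + the trace formula).
HONEST: bookkeeping; nothing located (S3ʷ, T, D, N, S1, S5ᵛ) is proved; width toward PXcof ∕ N_cof ∕ `IRcof` ∕ `IR` is 0; the Yang–Mills
mass gap (Clay) is NOT proved anywhere in this tree; R4 closes only the conditional finite-𝕋⁴ rung `BalabanLadder.UV`.
Pool prover ym-ir-line-pool-p3 g16.
-/

set_option autoImplicit false

noncomputable section

namespace Summit.QuantumFields.YangMills.Cruxes.IRcof.EquipartitionSeam.ThickSpeciesFlux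

open scoped BigOperators ComplexConjugate
open Finset
open Literature.Analysis.OperatorTheory (sum_fluxProjection_eq sum_apply_mul_fluxProjection_eq)

variable {Γ : Type} [AddCommGroup Γ] [Fintype Γ]

/-! ## §1 The non-trivial-flux mass from equipartition (function level) -/

/-- **Flux mass from equipartition.**  For `X : Γ → ℂ` with `‖X k − X 0‖ ≤ δ·Re X 0` for every `k`:
`Re X 0 − Re X̂(0) ≤ δ·Re X 0`, where `X̂(0) = |Γ|⁻¹ Σ_k X k` is the trivial-flux projection; i.e. the mass OUTSIDE the trivial sector,
`Σ_{ψ ≠ 0} Re X̂(ψ) = Re X 0 − Re X̂(0)` (completeness), is at most `δ·Re X 0`. -/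
theorem fluxMass_le_of_equipartition (X : Γ → ℂ) {δ : ℝ} (hequi : ∀ k, ‖X k - X 0‖ ≤ δ * (X 0).re) :
    (X 0).re - ((Fintype.card Γ : ℂ)⁻¹ * ∑ k, X k).re ≤ δ * (X 0).re := by
  have hcardpos : (0 : ℝ) < Fintype.card Γ := Nat.cast_pos.mpr Fintype.card_pos
  have hcard : (Fintype.card Γ : ℝ) ≠ 0 := hcardpos.ne'
  -- `Re X 0 − Re X̂ 0 = |Γ|⁻¹ Σ_k Re (X 0 − X k)`
  have hre : ((Fintype.card Γ : ℂ)⁻¹ * ∑ k, X k).re = (Fintype.card Γ : ℝ)⁻¹ * ∑ k, (X k).re := by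
    rw [Complex.mul_re]
    simp [Complex.re_sum]
  rw [hre]
  have h1 : (X 0).re - (Fintype.card Γ : ℝ)⁻¹ * ∑ k, (X k).re =
      (Fintype.card Γ : ℝ)⁻¹ * ∑ k, ((X 0).re - (X k).re) := by
    rw [Finset.sum_sub_distrib, Finset.sum_const, Finset.card_univ, nsmul_eq_mul]
    field_simp
  rw [h1]
  have h2 : ∑ k, ((X 0).re - (X k).re) ≤ ∑ _k : Γ, δ * (X 0).re := by
    refine Finset.sum_le_sum fun k _ => ?_
    calc (X 0).re - (X k).re = (X 0 - X k).re := by simp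
      _ ≤ ‖X 0 - X k‖ := Complex.re_le_norm _
      _ = ‖X k - X 0‖ := norm_sub_rev _ _
      _ ≤ δ * (X 0).re := hequi k
  rw [Finset.sum_const, Finset.card_univ, nsmul_eq_mul] at h2
  calc (Fintype.card Γ : ℝ)⁻¹ * ∑ k, ((X 0).re - (X k).re)
      ≤ (Fintype.card Γ : ℝ)⁻¹ * ((Fintype.card Γ : ℝ) * (δ * (X 0).re)) :=
        mul_le_mul_of_nonneg_left h2 (inv_nonneg.mpr hcardpos.le)
    _ = δ * (X 0).re := by field_simp

/-! ## §2 Flux-uniformity of the inserted traces from sector-wise domination -/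

/-- **Peeling, step 1 in flux currency.**  `X, W : Γ → ℂ` with sector-wise domination `‖Ŵ(ψ)‖ ≤ β·Re X̂(ψ)` (which contains the flux
positivity `Re X̂(ψ) ≥ 0` of `X` for `β > 0`) and equipartition `‖X k − X 0‖ ≤ δ·Re X 0` ⟹ `‖W k − W 0‖ ≤ 2·β·δ·Re X 0`. -/
theorem insertion_fluxUniform_flux (X W : Γ → ℂ) {β δ : ℝ} (hβ : 0 ≤ β)
    (hdom : ∀ ψ : AddChar Γ ℂ, ‖(Fintype.card Γ : ℂ)⁻¹ * ∑ k, conj (ψ k) * W k‖ ≤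
      β * ((Fintype.card Γ : ℂ)⁻¹ * ∑ k, conj (ψ k) * X k).re)
    (hequi : ∀ k, ‖X k - X 0‖ ≤ δ * (X 0).re) (k : Γ) :
    ‖W k - W 0‖ ≤ 2 * β * δ * (X 0).re := by
  classical
  set Xh : AddChar Γ ℂ → ℂ := fun ψ => (Fintype.card Γ : ℂ)⁻¹ * ∑ k, conj (ψ k) * X k with hXh
  set Wh : AddChar Γ ℂ → ℂ := fun ψ => (Fintype.card Γ : ℂ)⁻¹ * ∑ k, conj (ψ k) * W k with hWh
  -- Fourier inversion of `W` at `k` and at `0`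
  have hWk : W k = ∑ ψ : AddChar Γ ℂ, ψ k * Wh ψ := (sum_apply_mul_fluxProjection_eq W k).symm
  have hW0 : W 0 = ∑ ψ : AddChar Γ ℂ, Wh ψ := by
    have h := sum_apply_mul_fluxProjection_eq W 0
    simp only [AddChar.map_zero_eq_one, one_mul] at h
    exact h.symm
  have hdiff : W k - W 0 = ∑ ψ : AddChar Γ ℂ, (ψ k - 1) * Wh ψ := by
    rw [hWk, hW0, ← Finset.sum_sub_distrib]
    exact Finset.sum_congr rfl fun ψ _ => by ring
  -- termwise: the trivial character contributes 0, the others at most `2 β Re X̂(ψ)`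
  have hterm : ∀ ψ : AddChar Γ ℂ, ‖(ψ k - 1) * Wh ψ‖ ≤ 2 * β * (Xh ψ).re - (if ψ = 0 then 2 * β * (Xh ψ).re else 0) := by
    intro ψ
    by_cases hψ : ψ = 0
    · subst hψ
      simp
    · rw [if_neg hψ, sub_zero, norm_mul]
      have h1 : ‖ψ k - 1‖ ≤ 2 := by
        calc ‖ψ k - 1‖ ≤ ‖ψ k‖ + ‖(1 : ℂ)‖ := norm_sub_le _ _
          _ = 2 := by rw [AddChar.norm_apply, norm_one]; norm_num
      calc ‖ψ k - 1‖ * ‖Wh ψ‖ ≤ 2 * (β * (Xh ψ).re) :=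
            mul_le_mul h1 (hdom ψ) (norm_nonneg _) (by norm_num)
        _ = 2 * β * (Xh ψ).re := by ring
  -- sum: `Σ_ψ 2β Re X̂(ψ) − 2β Re X̂(0) = 2β (Re X 0 − Re X̂ 0) ≤ 2β δ Re X 0`
  have hsumX : ∑ ψ : AddChar Γ ℂ, (Xh ψ).re = (X 0).re := by
    have h := congrArg Complex.re (sum_fluxProjection_eq X)
    rw [Complex.re_sum] at h
    exact h
  have hX0 : Xh 0 = (Fintype.card Γ : ℂ)⁻¹ * ∑ k', X k' := by
    simp [hXh]
  rw [hdiff]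
  calc ‖∑ ψ : AddChar Γ ℂ, (ψ k - 1) * Wh ψ‖ ≤ ∑ ψ : AddChar Γ ℂ, ‖(ψ k - 1) * Wh ψ‖ := norm_sum_le _ _
    _ ≤ ∑ ψ : AddChar Γ ℂ, (2 * β * (Xh ψ).re - (if ψ = 0 then 2 * β * (Xh ψ).re else 0)) := Finset.sum_le_sum fun ψ _ => hterm ψ
    _ = 2 * β * (X 0).re - 2 * β * (Xh 0).re := by
        rw [Finset.sum_sub_distrib, Finset.sum_ite_eq' Finset.univ (0 : AddChar Γ ℂ), if_pos (Finset.mem_univ _),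
          ← Finset.mul_sum, hsumX]
    _ = 2 * β * ((X 0).re - ((Fintype.card Γ : ℂ)⁻¹ * ∑ k', X k').re) := by rw [hX0]; ring
    _ ≤ 2 * β * (δ * (X 0).re) :=
        mul_le_mul_of_nonneg_left (fluxMass_le_of_equipartition X hequi) (by positivity)
    _ = 2 * β * δ * (X 0).re := by ring

/-- `‖W 0‖ ≤ β·Re X 0` (sum the sector-wise domination over all fluxes; completeness). -/
theorem norm_insertion_le_flux (X W : Γ → ℂ) {β : ℝ}
    (hdom : ∀ ψ : AddChar Γ ℂ, ‖(Fintype.card Γ : ℂ)⁻¹ * ∑ k, conj (ψ k) * W k‖ ≤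
      β * ((Fintype.card Γ : ℂ)⁻¹ * ∑ k, conj (ψ k) * X k).re) :
    ‖W 0‖ ≤ β * (X 0).re := by
  classical
  have hW0 : W 0 = ∑ ψ : AddChar Γ ℂ, (Fintype.card Γ : ℂ)⁻¹ * ∑ k, conj (ψ k) * W k := by
    have h := sum_apply_mul_fluxProjection_eq W 0
    simp only [AddChar.map_zero_eq_one, one_mul] at h
    exact h.symm
  have hsumX : ∑ ψ : AddChar Γ ℂ, ((Fintype.card Γ : ℂ)⁻¹ * ∑ k, conj (ψ k) * X k).re = (X 0).re := by
    have h := congrArg Complex.re (sum_fluxProjection_eq X)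
    rw [Complex.re_sum] at h
    exact h
  rw [hW0]
  calc ‖∑ ψ : AddChar Γ ℂ, (Fintype.card Γ : ℂ)⁻¹ * ∑ k, conj (ψ k) * W k‖
      ≤ ∑ ψ : AddChar Γ ℂ, ‖(Fintype.card Γ : ℂ)⁻¹ * ∑ k, conj (ψ k) * W k‖ := norm_sum_le _ _
    _ ≤ ∑ ψ : AddChar Γ ℂ, β * ((Fintype.card Γ : ℂ)⁻¹ * ∑ k, conj (ψ k) * X k).re := Finset.sum_le_sum fun ψ _ => hdom ψ
    _ = β * (X 0).re := by rw [← Finset.mul_sum, hsumX]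

/-! ## §3 The peeling theorem in flux currency -/

/-- **★ PEELING THEOREM, flux-coefficient form.**  `X, W : Γ → ℂ` (twisted traces of the PSD block `𝕋^s` and of `𝕋^s` with the dressed
insertion), sector-wise insertion domination `‖Ŵ(ψ)‖ ≤ β·Re X̂(ψ)` (`β ≥ 0`; flux positivity of `X` is implicit in it), equipartition of `X`
at defect `δ`;
a second block known through its twisted traces `Z` with `‖Z k − Z₀‖ ≤ δ·Z₀` (`Z₀ ≥ 0`); `0 ≤ δ ≤ 1`; slack `β·Re X 0 ≤ K·Z₀`.  Then
`‖W a·Z b − W b·Z a‖ ≤ 10·K·δ·Z₀²`. -/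
theorem eblind_thick_flux (X W Z : Γ → ℂ) {β δ Z₀ K : ℝ} (hβ : 0 ≤ β)
    (hdom : ∀ ψ : AddChar Γ ℂ, ‖(Fintype.card Γ : ℂ)⁻¹ * ∑ k, conj (ψ k) * W k‖ ≤
      β * ((Fintype.card Γ : ℂ)⁻¹ * ∑ k, conj (ψ k) * X k).re)
    (hequiX : ∀ k, ‖X k - X 0‖ ≤ δ * (X 0).re) (hZ₀ : 0 ≤ Z₀) (hequiZ : ∀ k, ‖Z k - (Z₀ : ℂ)‖ ≤ δ * Z₀)
    (hδ : 0 ≤ δ) (hδ1 : δ ≤ 1) (hslack : β * (X 0).re ≤ K * Z₀) (a b : Γ) :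
    ‖W a * Z b - W b * Z a‖ ≤ 10 * K * δ * Z₀ ^ 2 := by
  have hWu : ∀ u, ‖W u - W 0‖ ≤ 2 * β * δ * (X 0).re :=
    fun u => insertion_fluxUniform_flux X W hβ hdom hequiX u
  have hw : ‖W 0‖ ≤ β * (X 0).re := norm_insertion_le_flux X W hdom
  have h := ThickSpeciesDatum.pairBound_of_uniform W Z (W 0) Z₀ (2 * β * δ * (X 0).re) (β * (X 0).re) δ hZ₀ hWu hw hequiZ a b
  refine h.trans ?_
  have hβX : 0 ≤ β * (X 0).re := (norm_nonneg _).trans hw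
  calc 2 * (2 * β * δ * (X 0).re) * ((1 + δ) * Z₀) + 2 * (β * (X 0).re) * δ * Z₀
      = (4 * (1 + δ) + 2) * (δ * Z₀) * (β * (X 0).re) := by ring
    _ ≤ (4 * 2 + 2) * (δ * Z₀) * (K * Z₀) := by
        have h1 : 4 * (1 + δ) + 2 ≤ (4 * 2 + 2 : ℝ) := by linarith
        have h2 : (0 : ℝ) ≤ 4 * (1 + δ) + 2 := by linarith
        have h3 : 0 ≤ δ * Z₀ := mul_nonneg hδ hZ₀
        gcongr
    _ = 10 * K * δ * Z₀ ^ 2 := by ring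

end Summit.QuantumFields.YangMills.Cruxes.IRcof.EquipartitionSeam.ThickSpeciesFlux

end
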